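import Literature.Analysis.FluidPDE.TaoAveragedNondegeneracy
import Mathlib.Analysis.InnerProductSpace.NormDet
import HarnessLib

/-!
# Tao 2016, §3.8: the plane `ηⱼ^⊥`, the polar form `Yⱼ = |Yⱼ| R_{ηⱼ}^{αⱼ} n`, and the tensor
representation (3.21) ("bigmess-4") for fixed base vectors

T. Tao, *Finite time blowup for an averaged three-dimensional Navier–Stokes equation*,
J. Amer. Math. Soc. **29** (2016), 601–674 = arXiv:1402.0290v3 (held as `paper:arxiv-1402.0290`;
equation and page numbers are those of that text), §3.8 (pp. 19–20): "Thus it suffices to find a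
smooth function `F''` with the representation (3.21) … as `Yⱼ ∈ ηⱼ^⊥`, this means that we may
write `Yⱼ = R_{ηⱼ}^{αⱼ} n` … each of the three coefficients of `R_{ηⱼ}^{αⱼ} n ∈ ℝ³` is a complex
linear combination of `e^{-iαⱼ}` and `e^{iαⱼ}` … Thus to show (3.21), it suffices to obtain a
representation (3.23)".

Building on `TaoAveragedNondegeneracy.lean` (the rotations `rodRot` = `R_ξ^θ`, `Θ` = `thetaFn`,
the coefficients `c_σ` = `cSigma`, the non-degeneracy (3.24) and the Fourier inversion (3.23)
`exp_eq_integral_thetaFn`), this file carries out that paragraph for *fixed* base vectors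
`η = (η₁, η₂, η₃)` with a common unit normal `n`:

* `cross_cross_eq_smul_sub` (BAC–CAB), `triple_smul_eq` (reciprocal-basis expansion),
  `eq_inner_smul_add_of_inner_eq_zero` — `Y = (Y·n) n + (Y·(u×n)) (u×n)` for `Y ⊥ ξ`;
* `rodRot_rodRot_of_inner_eq_zero`, `rodRot_rodRot` — the group law `R_ξ^θ R_ξ^φ = R_ξ^{θ+φ}`
  (on `ξ^⊥`, then on `ℝ³`); `rodRotEquiv` — **`R_ξ^θ` as a linear isometric automorphism of
  `ℝ³`** with `det_rodRotEquiv` — **`det R_ξ^θ = 1`** (so `R_ξ^θ ∈ SO(3)`, as needed for the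
  rotation data of the ansatz (3.20): `R = (R^{θ/2})²` and isometries have `|det| = 1`);
* `exists_eq_norm_smul_rodRot` — **the polar form `Y = |Y| R_ξ^α n`** of a vector `Y ⊥ ξ`;
* `rotCoeff`, `rodRot_apply_eq_sum_rotCoeff` — **`(R_ξ^α n)_a = Σ_{s=±1} e^{isα} V_ξ^s(n)_a`**;
* `angleWeight` (`F_σ` of (3.23)), `tensorWeight` (**the explicit `F''` of (3.21)**),
  `prod_rodRot_apply_eq_integral` and **`tensor_eq_integral_realΛ_rodRot` — the representation
  (3.21): `(Y₁)_a (Y₂)_b (Y₃)_c = ∫_{(0,2π]³} F''_{abc}(θ) Λ_η(R_{η₁}^{θ₁}Y₁, R_{η₂}^{θ₂}Y₂, R_{η₃}^{θ₃}Y₃) dθ`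
  for all `Yⱼ ∈ ηⱼ^⊥`**, under the non-degeneracy hypothesis `c_σ(η, n) ≠ 0` (all `σ`), which
  `cSigma_ne_zero_near_xi0` provides for `η` near the configuration (3.7).

The smooth dependence of `F''` on `η ∈ Γ` (through `n(η)`, `uⱼ(η)` and `c_σ(η)⁻¹`), the
averaging over `S ∈ SO(3)` and the inversion of the tensored rotations (§3.7), are left to the
user of (3.21); here `η` is a parameter.

## References

* T. Tao, J. Amer. Math. Soc. 29 (2016), 601–674, arXiv:1402.0290v3, §3.8 (3.21)–(3.23)
  pp. 19–20; §3.9 (3.24) p. 20. Key `Tao2016AveragedNS`.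
-/

noncomputable section

open Real Matrix MeasureTheory
open scoped RealInnerProductSpace

namespace Literature.Analysis.FluidPDE.Tao2016

/-- Local notation for physical / frequency space `ℝ³`. -/
local notation "ℝ³" => EuclideanSpace ℝ (Fin 3)

/-! ### More algebra of the cross product: BAC–CAB and the reciprocal-basis expansion -/

/-- **BAC–CAB**: `a × (b × c) = (a·c) b − (a·b) c`. [folklore] -/
theorem cross_cross_eq_smul_sub (a b c : ℝ³) : cross a (cross b c) = ⟪a, c⟫ • b - ⟪a, b⟫ • c := by
  ext i
  fin_cases i <;>
    simp [cross_apply_zero, cross_apply_one, cross_apply_two, real_inner_fin3] <;> ring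

/-- **Reciprocal-basis expansion**: `(a · (b × c)) X = (X·a) (b × c) + (X·b) (c × a) + (X·c) (a × b)`
for all `a, b, c, X ∈ ℝ³` (a polynomial identity; for a positively oriented orthonormal triple it
is the expansion of `X` in that basis). [folklore] -/
theorem triple_smul_eq (a b c X : ℝ³) :
    ⟪a, cross b c⟫ • X = ⟪X, a⟫ • cross b c + ⟪X, b⟫ • cross c a + ⟪X, c⟫ • cross a b := by
  ext i
  fin_cases i <;>
    simp [cross_apply_zero, cross_apply_one, cross_apply_two, real_inner_fin3] <;> ring

/-- The cross product is additive in the first argument. [folklore] -/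
theorem cross_add_left (a b c : ℝ³) : cross (a + b) c = cross a c + cross b c := by
  simp [cross, map_add]

/-! ### The plane `ξ^⊥`: the orthonormal frame `(n, u × n)` and the rotation group law -/

section Plane

variable {ξ n : ℝ³}

/-- For a unit `n ⊥ ξ` (`ξ ≠ 0`), `u × n` is a unit vector (`u = ξ/|ξ|`). [folklore] -/
theorem norm_cross_udir_normal (hξ : ξ ≠ 0) (hn1 : ‖n‖ = 1) (hn : ⟪n, ξ⟫ = 0) :
    ‖cross (udir ξ) n‖ = 1 := by
  have hu1 : ‖udir ξ‖ = 1 := norm_udir hξ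
  have hun : ⟪udir ξ, n⟫ = 0 := by rw [udir, real_inner_smul_left, real_inner_comm, hn, mul_zero]
  have h := norm_cross_sq (udir ξ) n
  rw [hu1, hn1, hun] at h
  nlinarith [norm_nonneg (cross (udir ξ) n)]

/-- **Expansion in the plane `ξ^⊥`**: a vector `Y ⊥ ξ` is `Y = (Y·n) n + (Y·(u×n)) (u×n)` for a
unit `n ⊥ ξ` (the frame `(u, n, u × n)` is orthonormal and positively oriented). [folklore] -/
theorem eq_inner_smul_add_of_inner_eq_zero (hξ : ξ ≠ 0) (hn1 : ‖n‖ = 1) (hn : ⟪n, ξ⟫ = 0) {Y : ℝ³}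
    (hY : ⟪Y, ξ⟫ = 0) :
    Y = ⟪Y, n⟫ • n + ⟪Y, cross (udir ξ) n⟫ • cross (udir ξ) n := by
  set u := udir ξ with hu
  set w := cross u n with hw
  have hu1 : ‖u‖ = 1 := norm_udir hξ
  have huu : ⟪u, u⟫ = 1 := by rw [real_inner_self_eq_norm_sq, hu1, one_pow]
  have hnn : ⟪n, n⟫ = 1 := by rw [real_inner_self_eq_norm_sq, hn1, one_pow]
  have hun : ⟪u, n⟫ = 0 := by rw [hu, udir, real_inner_smul_left, real_inner_comm, hn, mul_zero]
  have hnu : ⟪n, u⟫ = 0 := by rw [real_inner_comm, hun]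
  have hYu : ⟪Y, u⟫ = 0 := by rw [hu, udir, real_inner_smul_right, hY, mul_zero]
  have hww : ⟪w, w⟫ = 1 := by
    rw [hw, inner_cross_cross, huu, hnn, hun, hnu]; ring
  -- `n × w = u` (BAC–CAB), so `u · (n × w) = 1`
  have hnw : cross n w = u := by
    rw [hw, cross_cross_eq_smul_sub, hnn, hnu, one_smul, zero_smul, sub_zero]
  have hvol : ⟪u, cross n w⟫ = 1 := by rw [hnw, huu]
  -- the difference is orthogonal to the frame
  set D := Y - (⟪Y, n⟫ • n + ⟪Y, w⟫ • w) with hD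
  have hDu : ⟪D, u⟫ = 0 := by
    rw [hD, inner_sub_left, inner_add_left, real_inner_smul_left, real_inner_smul_left, hYu, hnu, hw,
      inner_cross_self_left]
    ring
  have hDn : ⟪D, n⟫ = 0 := by
    rw [hD, inner_sub_left, inner_add_left, real_inner_smul_left, real_inner_smul_left, hnn, hw,
      inner_cross_self_right]
    ring
  have hDw : ⟪D, w⟫ = 0 := by
    rw [hD, inner_sub_left, inner_add_left, real_inner_smul_left, real_inner_smul_left, hww,
      show ⟪n, w⟫ = 0 from by rw [hw]; exact inner_self_cross_right u n]
    ring
  have hexp := triple_smul_eq u n w D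
  rw [hvol, one_smul, hDu, hDn, hDw, zero_smul, zero_smul, zero_smul, add_zero, add_zero] at hexp
  rw [hD, sub_eq_zero] at hexp
  exact hexp

/-- `cos φ X + sin φ (u × X)` stays in `ξ^⊥` when `X ∈ ξ^⊥`. [folklore] -/
theorem inner_rodRot_axis_eq_zero {X : ℝ³} (hX : ⟪X, ξ⟫ = 0) (φ : ℝ) : ⟪rodRot ξ φ X, ξ⟫ = 0 := by
  rw [rodRot_of_inner_eq_zero hX, inner_add_left, real_inner_smul_left, real_inner_smul_left, hX,
    mul_zero, zero_add, udir, cross_smul_left, real_inner_smul_left, inner_cross_self_left, mul_zero,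
    mul_zero]

/-- **The group law of the rotations about `ξ` on the plane `ξ^⊥`**:
`R_ξ^θ (R_ξ^φ X) = R_ξ^{θ+φ} X` for `X ⊥ ξ`, `ξ ≠ 0`. [folklore] -/
theorem rodRot_rodRot_of_inner_eq_zero (hξ : ξ ≠ 0) {X : ℝ³} (hX : ⟪X, ξ⟫ = 0) (θ φ : ℝ) :
    rodRot ξ θ (rodRot ξ φ X) = rodRot ξ (θ + φ) X := by
  have hu1 : ‖udir ξ‖ = 1 := norm_udir hξ
  have huu : ⟪udir ξ, udir ξ⟫ = 1 := by rw [real_inner_self_eq_norm_sq, hu1, one_pow]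
  have huX : ⟪udir ξ, X⟫ = 0 := by rw [udir, real_inner_smul_left, real_inner_comm, hX, mul_zero]
  rw [rodRot_of_inner_eq_zero (inner_rodRot_axis_eq_zero hX φ), rodRot_of_inner_eq_zero hX,
    rodRot_of_inner_eq_zero hX, cross_add_right, cross_smul_right, cross_smul_right,
    cross_cross_eq_smul_sub, huX, huu, zero_smul, one_smul, zero_sub, Real.cos_add, Real.sin_add]
  module

/-- **Polar form in the plane `ξ^⊥`**: every `Y ⊥ ξ` is `Y = |Y| R_ξ^α n` for some angle `α`
(§3.8: "as `Yⱼ ∈ ηⱼ^⊥`, this means that we may write `Yⱼ = R_{ηⱼ}^{αⱼ} n`" for unit `Yⱼ`). [cite: Tao2016AveragedNS, §3.8 p. 19] -/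
theorem exists_eq_norm_smul_rodRot (hξ : ξ ≠ 0) (hn1 : ‖n‖ = 1) (hn : ⟪n, ξ⟫ = 0) {Y : ℝ³}
    (hY : ⟪Y, ξ⟫ = 0) : ∃ α : ℝ, Y = ‖Y‖ • rodRot ξ α n := by
  set p : ℝ := ⟪Y, n⟫ with hp
  set q : ℝ := ⟪Y, cross (udir ξ) n⟫ with hq
  set z : ℂ := (p : ℂ) + (q : ℂ) * Complex.I with hz
  have hYexp : Y = p • n + q • cross (udir ξ) n := eq_inner_smul_add_of_inner_eq_zero hξ hn1 hn hY
  -- `|z| = |Y|`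
  have hw1 : ‖cross (udir ξ) n‖ = 1 := norm_cross_udir_normal hξ hn1 hn
  have hnw : ⟪n, cross (udir ξ) n⟫ = 0 := inner_self_cross_right _ _
  have hnorm : ‖z‖ = ‖Y‖ := by
    have h1 : ‖Y‖ ^ 2 = p ^ 2 + q ^ 2 := by
      have hnn : ⟪n, n⟫ = 1 := by rw [real_inner_self_eq_norm_sq, hn1, one_pow]
      have hww : ⟪cross (udir ξ) n, cross (udir ξ) n⟫ = 1 := by
        rw [real_inner_self_eq_norm_sq, hw1, one_pow]
      have hwn : ⟪cross (udir ξ) n, n⟫ = 0 := inner_cross_self_right _ _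
      rw [← real_inner_self_eq_norm_sq]
      conv_lhs => rw [hYexp]
      simp only [inner_add_left, inner_add_right, real_inner_smul_left, real_inner_smul_right, hnn, hww,
        hnw, hwn, mul_zero, add_zero, zero_add, mul_one]
      ring
    have h2 : ‖z‖ ^ 2 = p ^ 2 + q ^ 2 := by
      rw [Complex.sq_norm, Complex.normSq_apply, hz]
      simp
      ring
    nlinarith [norm_nonneg z, norm_nonneg Y, sq_nonneg (‖z‖ - ‖Y‖), sq_nonneg (‖z‖ + ‖Y‖)]
  refine ⟨Complex.arg z, ?_⟩
  have hpolar := Complex.norm_mul_exp_arg_mul_I z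
  rw [hnorm] at hpolar
  -- real and imaginary parts of `|Y| e^{iα} = p + iq`
  have hre : ‖Y‖ * Real.cos (Complex.arg z) = p := by
    have := congrArg Complex.re hpolar
    simpa [hz, Complex.exp_mul_I, Complex.cos_ofReal_re, Complex.sin_ofReal_re, Complex.cos_ofReal_im,
      Complex.sin_ofReal_im] using this
  have him : ‖Y‖ * Real.sin (Complex.arg z) = q := by
    have := congrArg Complex.im hpolar
    simpa [hz, Complex.exp_mul_I, Complex.cos_ofReal_re, Complex.sin_ofReal_re, Complex.cos_ofReal_im,
      Complex.sin_ofReal_im] using this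
  rw [rodRot_of_inner_eq_zero hn, smul_add, smul_smul, smul_smul, hre, him]
  exact hYexp

end Plane

/-! ### `R_ξ^θ ∈ SO(3)`: the rotation as a linear isometry of determinant one -/

section SO3

variable {ξ : ℝ³}

/-- The unit axis vector is fixed: `R_ξ^θ u = u`. [folklore] -/
theorem rodRot_udir (ξ : ℝ³) (θ : ℝ) : rodRot ξ θ (udir ξ) = udir ξ := by
  rw [udir, rodRot_smul, rodRot_axis]

/-- **The full group law** `R_ξ^θ (R_ξ^φ X) = R_ξ^{θ+φ} X` for all `X ∈ ℝ³` (`ξ ≠ 0`): the axis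
component is fixed and the plane `ξ^⊥` is rotated. [folklore] -/
theorem rodRot_rodRot (hξ : ξ ≠ 0) (θ φ : ℝ) (X : ℝ³) :
    rodRot ξ θ (rodRot ξ φ X) = rodRot ξ (θ + φ) X := by
  set a : ℝ := ⟪X, udir ξ⟫ with ha
  set P : ℝ³ := X - a • udir ξ with hP
  have hPξ : ⟪P, ξ⟫ = 0 := by
    have hu1 : ‖udir ξ‖ = 1 := norm_udir hξ
    have hPu : ⟪P, udir ξ⟫ = 0 := by
      rw [hP, inner_sub_left, real_inner_smul_left, real_inner_self_eq_norm_sq, hu1, ← ha]; ring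
    have : ξ = ‖ξ‖ • udir ξ := by
      rw [udir, smul_smul, mul_inv_cancel₀ (norm_ne_zero_iff.mpr hξ), one_smul]
    rw [this, real_inner_smul_right, hPu, mul_zero]
  have hX : X = a • udir ξ + P := by rw [hP]; abel
  -- rotate the decomposition twice, resp. once
  have key : ∀ ψ : ℝ, rodRot ξ ψ X = a • udir ξ + rodRot ξ ψ P := fun ψ => by
    conv_lhs => rw [hX]
    rw [rodRot_add, rodRot_smul, rodRot_udir]
  rw [key φ, rodRot_add, rodRot_smul, rodRot_udir, rodRot_rodRot_of_inner_eq_zero hξ hPξ, ← key (θ + φ)]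

/-- `R_ξ^θ` as a linear map. [cite: Tao2016AveragedNS, §3.7 footnote 6 p. 19] -/
def rodRotLinear (ξ : ℝ³) (θ : ℝ) : ℝ³ →ₗ[ℝ] ℝ³ where
  toFun := rodRot ξ θ
  map_add' := rodRot_add ξ θ
  map_smul' r X := rodRot_smul ξ θ r X

/-- `R_ξ^θ` as a linear isometry (`ξ ≠ 0`). [cite: Tao2016AveragedNS, §3.7 footnote 6 p. 19] -/
def rodRotIsometry (hξ : ξ ≠ 0) (θ : ℝ) : ℝ³ →ₗᵢ[ℝ] ℝ³ :=
  ⟨rodRotLinear ξ θ, norm_rodRot hξ θ⟩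

/-- **`R_ξ^θ` as an element of `O(3)`**: a linear isometric automorphism of `ℝ³` (`ξ ≠ 0`); with
`det_rodRotEquiv` it lies in `SO(3)`, as used in the ansatz (3.20). [cite: Tao2016AveragedNS, §3.7 (3.20) p. 19] -/
def rodRotEquiv (hξ : ξ ≠ 0) (θ : ℝ) : ℝ³ ≃ₗᵢ[ℝ] ℝ³ :=
  (rodRotIsometry hξ θ).toLinearIsometryEquiv rfl

/-- `rodRotEquiv` acts by `rodRot`. [folklore] -/
@[simp]
theorem rodRotEquiv_apply (hξ : ξ ≠ 0) (θ : ℝ) (X : ℝ³) : rodRotEquiv hξ θ X = rodRot ξ θ X := rfl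

/-- The underlying linear map of `rodRotEquiv`. [folklore] -/
theorem rodRotEquiv_toLinearMap (hξ : ξ ≠ 0) (θ : ℝ) :
    ((rodRotEquiv hξ θ).toLinearEquiv : ℝ³ →ₗ[ℝ] ℝ³) = rodRotLinear ξ θ :=
  LinearMap.ext fun _ => rfl

/-- **`det R_ξ^θ = 1`**: `R_ξ^θ = (R_ξ^{θ/2})²` has non-negative determinant, and a linear isometry
has determinant `±1`. [folklore] -/
theorem det_rodRotEquiv (hξ : ξ ≠ 0) (θ : ℝ) :
    LinearMap.det ((rodRotEquiv hξ θ).toLinearEquiv : ℝ³ →ₗ[ℝ] ℝ³) = 1 := by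
  rw [rodRotEquiv_toLinearMap]
  -- `|det| = 1`
  have habs : |LinearMap.det (rodRotLinear ξ θ)| = 1 := by
    rw [← LinearMap.normDet_eq_abs_det]
    exact (rodRotIsometry hξ θ).normDet_eq_one
  -- `det ≥ 0` from the square root `R^{θ/2}`
  have hsq : rodRotLinear ξ θ = rodRotLinear ξ (θ / 2) ∘ₗ rodRotLinear ξ (θ / 2) := by
    refine LinearMap.ext fun X => ?_
    change rodRot ξ θ X = rodRot ξ (θ / 2) (rodRot ξ (θ / 2) X)
    rw [rodRot_rodRot hξ, add_halves]
  have hnonneg : 0 ≤ LinearMap.det (rodRotLinear ξ θ) := by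
    rw [hsq, LinearMap.det_comp]
    exact mul_self_nonneg _
  rw [abs_of_nonneg hnonneg] at habs
  exact habs

end SO3

/-! ### `R_ξ^α n` as a trigonometric polynomial in `α` (§3.8, last paragraph) -/

/-- The coefficient vectors `V_ξ^{±}(n) = ½(n ∓ i u × n) ∈ ℂ³`: "each of the three coefficients of
`R_{ηⱼ}^{αⱼ} n ∈ ℝ³` is a complex linear combination of `e^{-iαⱼ}` and `e^{iαⱼ}`" (§3.8, p. 19). [cite: Tao2016AveragedNS, §3.8 p. 19] -/
def rotCoeff (ξ n : ℝ³) (s : ℤˣ) (a : Fin 3) : ℂ :=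
  ((n a : ℝ) : ℂ) / 2 - Complex.I * ((s : ℤ) : ℂ) * ((cross (udir ξ) n a : ℝ) : ℂ) / 2

/-- **`(R_ξ^α n)_a = Σ_{s=±1} e^{isα} V_ξ^s(n)_a`** for `n ⊥ ξ`. [cite: Tao2016AveragedNS, §3.8 p. 19] -/
theorem rodRot_apply_eq_sum_rotCoeff {ξ n : ℝ³} (hn : ⟪n, ξ⟫ = 0) (α : ℝ) (a : Fin 3) :
    ((rodRot ξ α n a : ℝ) : ℂ) =
      ∑ s : ℤˣ, Complex.exp (Complex.I * ((s : ℤ) : ℂ) * (α : ℂ)) * rotCoeff ξ n s a := by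
  rw [rodRot_of_inner_eq_zero hn, UnitsInt.univ, Finset.sum_pair (by decide : (1 : ℤˣ) ≠ -1)]
  simp only [rotCoeff, PiLp.add_apply, PiLp.smul_apply, smul_eq_mul, Units.val_one, Units.val_neg,
    Int.cast_one, Int.cast_neg, mul_one, mul_neg, neg_mul]
  push_cast
  simp only [Complex.cos, Complex.sin]
  simp only [mul_comm Complex.I, Complex.exp_neg, neg_mul]
  have hE : Complex.exp ((α : ℂ) * Complex.I) ≠ 0 := Complex.exp_ne_zero _
  field_simp
  ring_nf

/-! ### The tensor representation (3.21) ("bigmess-4") for fixed base vectors -/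

section Synthesis

variable {η : Fin 3 → ℝ³} {n : ℝ³}

/-- The smooth weights `F_σ(θ) = e^{-iσ·θ}/((2π)³ c_σ(η))` of (3.23). [cite: Tao2016AveragedNS, §3.8–3.9 (3.23) p. 19] -/
def angleWeight (η : Fin 3 → ℝ³) (n : ℝ³) (σ : Fin 3 → ℤˣ) (θ : Fin 3 → ℝ) : ℂ :=
  (cSigma η n σ)⁻¹ / (2 * π) ^ 3 * Complex.exp (-(Complex.I * ∑ j, ((σ j : ℤ) : ℂ) * (θ j : ℂ)))

/-- **The tensor-valued weight `F''(θ, η)` of (3.21)** ("bigmess-4"), for fixed `η` and the unit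
normal `n`: `F''_{abc}(θ) = Σ_σ F_σ(θ) V^{σ₁}_{η₁}(n)_a V^{σ₂}_{η₂}(n)_b V^{σ₃}_{η₃}(n)_c`. [cite: Tao2016AveragedNS, §3.8 (3.21) p. 19] -/
def tensorWeight (η : Fin 3 → ℝ³) (n : ℝ³) (θ : Fin 3 → ℝ) (a b c : Fin 3) : ℂ :=
  ∑ σ : Fin 3 → ℤˣ, angleWeight η n σ θ *
    (rotCoeff (η 0) n (σ 0) a * rotCoeff (η 1) n (σ 1) b * rotCoeff (η 2) n (σ 2) c)

/-- `Θ_η` is continuous. [folklore] -/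
theorem continuous_thetaFn (η : Fin 3 → ℝ³) (n : ℝ³) : Continuous (thetaFn η n) := by
  unfold thetaFn realΛ rodRot
  fun_prop

/-- The weights `F_σ` are continuous in `θ`. [folklore] -/
theorem continuous_angleWeight (η : Fin 3 → ℝ³) (n : ℝ³) (σ : Fin 3 → ℤˣ) :
    Continuous (angleWeight η n σ) := by
  unfold angleWeight
  fun_prop

/-- **(3.23) summed against the coefficient tensors: the angle form of (3.21).** For unit
`n ⊥ ηⱼ` and `c_σ(η) ≠ 0` for all `σ`,
`Πⱼ (R_{ηⱼ}^{αⱼ} n)_{aⱼ} = ∫_{(0,2π]³} F''_{a}(θ) Θ_η(θ + α) dθ`. [cite: Tao2016AveragedNS, §3.8 (3.21)–(3.23) p. 19] -/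
theorem prod_rodRot_apply_eq_integral (hn1 : ‖n‖ = 1) (hn : ∀ j, ⟪n, η j⟫ = 0)
    (hc : ∀ σ, cSigma η n σ ≠ 0) (α : Fin 3 → ℝ) (a b c : Fin 3) :
    ((rodRot (η 0) (α 0) n a : ℝ) : ℂ) * ((rodRot (η 1) (α 1) n b : ℝ) : ℂ) *
        ((rodRot (η 2) (α 2) n c : ℝ) : ℂ) =
      ∫ θ in Set.pi Set.univ (fun _ : Fin 3 => Set.Ioc (0 : ℝ) (2 * π)),
        tensorWeight η n θ a b c * (thetaFn η n (θ + α) : ℂ) := by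
  -- right-hand side: a finite sum of the integrals of (3.23)
  have hint : ∀ σ, IntegrableOn (fun θ : Fin 3 → ℝ => angleWeight η n σ θ *
      (rotCoeff (η 0) n (σ 0) a * rotCoeff (η 1) n (σ 1) b * rotCoeff (η 2) n (σ 2) c) *
        (thetaFn η n (θ + α) : ℂ)) (Set.pi Set.univ fun _ : Fin 3 => Set.Ioc (0 : ℝ) (2 * π)) volume := by
    intro σ
    refine IntegrableOn.mono_set ?_ (Set.pi_mono fun _ _ => Set.Ioc_subset_Icc_self)
    refine Continuous.continuousOn ?_ |>.integrableOn_compact (isCompact_univ_pi fun _ => isCompact_Icc)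
    have h1 := continuous_angleWeight η n σ
    have h2 : Continuous fun θ : Fin 3 → ℝ => (thetaFn η n (θ + α) : ℂ) :=
      Complex.continuous_ofReal.comp ((continuous_thetaFn η n).comp (continuous_id.add continuous_const))
    exact (h1.mul continuous_const).mul h2
  have hrhs : ∫ θ in Set.pi Set.univ (fun _ : Fin 3 => Set.Ioc (0 : ℝ) (2 * π)),
      tensorWeight η n θ a b c * (thetaFn η n (θ + α) : ℂ) =
        ∑ σ : Fin 3 → ℤˣ, (rotCoeff (η 0) n (σ 0) a * rotCoeff (η 1) n (σ 1) b * rotCoeff (η 2) n (σ 2) c) *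
          Complex.exp (Complex.I * ∑ j, ((σ j : ℤ) : ℂ) * (α j : ℂ)) := by
    simp only [tensorWeight, Finset.sum_mul]
    rw [integral_finsetSum _ fun σ _ => hint σ]
    refine Finset.sum_congr rfl fun σ _ => ?_
    rw [exp_eq_integral_thetaFn hn1 hn σ (hc σ) α, ← integral_const_mul]
    refine setIntegral_congr_fun (MeasurableSet.univ_pi fun _ => measurableSet_Ioc) fun θ _ => ?_
    simp only [angleWeight]
    ring
  rw [hrhs]
  -- left-hand side: expand the three factors
  rw [rodRot_apply_eq_sum_rotCoeff (hn 0), rodRot_apply_eq_sum_rotCoeff (hn 1),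
    rodRot_apply_eq_sum_rotCoeff (hn 2), sum_signVec3]
  simp only [UnitsInt.univ, Finset.sum_pair (by decide : (1 : ℤˣ) ≠ -1), Fin.sum_univ_three,
    Matrix.cons_val_zero, Matrix.cons_val_one, Matrix.cons_val_two, Matrix.head_cons, Matrix.tail_cons,
    Units.val_one, Units.val_neg, Int.cast_one, Int.cast_neg, mul_one, mul_neg, neg_mul, one_mul]
  simp only [mul_add, mul_neg, Complex.exp_add, Complex.exp_neg]
  ring

/-- `Λ` scales trilinearly. [cite: Tao2016AveragedNS, (1.4)] -/
theorem realΛ_smul (ξ₁ ξ₂ : ℝ³) (r₀ r₁ r₂ : ℝ) (X₀ X₁ X₂ : ℝ³) :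
    realΛ ξ₁ ξ₂ (r₀ • X₀) (r₁ • X₁) (r₂ • X₂) = r₀ * r₁ * r₂ * realΛ ξ₁ ξ₂ X₀ X₁ X₂ := by
  simp only [realΛ, real_inner_smul_left, real_inner_smul_right]
  ring

/-- **The tensor representation (3.21) ("bigmess-4") for fixed base vectors.** Let `ηⱼ ≠ 0`
(`j = 1,2,3`) admit a common unit normal `n` with `c_σ(η, n) ≠ 0` for all eight sign patterns
(non-degeneracy (3.24), e.g. `η` near `ξ⁰` by `cSigma_ne_zero_near_xi0`). Then for all
`Yⱼ ∈ ηⱼ^⊥` and all components `a, b, c`,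
`(Y₁)_a (Y₂)_b (Y₃)_c = ∫_{(0,2π]³} F''_{abc}(θ) Λ_{η₁,η₂,η₃}(R_{η₁}^{θ₁} Y₁, R_{η₂}^{θ₂} Y₂, R_{η₃}^{θ₃} Y₃) dθ`
with the explicit weight `F'' = tensorWeight η n` (continuous, a trigonometric polynomial in
`θ`): "Thus, if we can find a smooth function `F''` with the property (3.21) … it suffices to find a
smooth function `F''` with the representation (3.21)" — here found, for each admissible `η`, by
the polar form `Yⱼ = |Yⱼ| R_{ηⱼ}^{αⱼ} n`, the group law `R^θ R^α = R^{θ+α}` on `ηⱼ^⊥`, the expansion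
of `R^α n` in `e^{±iα}` and the Fourier inversion (3.23). [cite: Tao2016AveragedNS, §3.8 (3.21) p. 19] -/
theorem tensor_eq_integral_realΛ_rodRot (hη : ∀ j, η j ≠ 0) (hn1 : ‖n‖ = 1) (hn : ∀ j, ⟪n, η j⟫ = 0)
    (hc : ∀ σ, cSigma η n σ ≠ 0) (Y : Fin 3 → ℝ³) (hY : ∀ j, ⟪Y j, η j⟫ = 0) (a b c : Fin 3) :
    ((Y 0 a : ℝ) : ℂ) * ((Y 1 b : ℝ) : ℂ) * ((Y 2 c : ℝ) : ℂ) =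
      ∫ θ in Set.pi Set.univ (fun _ : Fin 3 => Set.Ioc (0 : ℝ) (2 * π)),
        tensorWeight η n θ a b c *
          (realΛ (η 0) (η 1) (rodRot (η 0) (θ 0) (Y 0)) (rodRot (η 1) (θ 1) (Y 1))
            (rodRot (η 2) (θ 2) (Y 2)) : ℂ) := by
  -- polar form of the three vectors
  choose α hα using fun j => exists_eq_norm_smul_rodRot (hη j) hn1 (hn j) (hY j)
  -- the integrand is `|Y₁||Y₂||Y₃| F'' Θ(θ + α)`
  have hΛ : ∀ θ : Fin 3 → ℝ,
      realΛ (η 0) (η 1) (rodRot (η 0) (θ 0) (Y 0)) (rodRot (η 1) (θ 1) (Y 1)) (rodRot (η 2) (θ 2) (Y 2)) =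
        ‖Y 0‖ * ‖Y 1‖ * ‖Y 2‖ * thetaFn η n (θ + α) := by
    intro θ
    conv_lhs => rw [hα 0, hα 1, hα 2]
    rw [rodRot_smul, rodRot_smul, rodRot_smul,
      rodRot_rodRot_of_inner_eq_zero (hη 0) (hn 0), rodRot_rodRot_of_inner_eq_zero (hη 1) (hn 1),
      rodRot_rodRot_of_inner_eq_zero (hη 2) (hn 2), realΛ_smul]
    rfl
  simp_rw [hΛ]
  have hI : ∫ θ in Set.pi Set.univ (fun _ : Fin 3 => Set.Ioc (0 : ℝ) (2 * π)),
      tensorWeight η n θ a b c * ((‖Y 0‖ * ‖Y 1‖ * ‖Y 2‖ * thetaFn η n (θ + α) : ℝ) : ℂ) =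
        ((‖Y 0‖ * ‖Y 1‖ * ‖Y 2‖ : ℝ) : ℂ) *
          ∫ θ in Set.pi Set.univ (fun _ : Fin 3 => Set.Ioc (0 : ℝ) (2 * π)),
            tensorWeight η n θ a b c * (thetaFn η n (θ + α) : ℂ) := by
    rw [← integral_const_mul]
    refine setIntegral_congr_fun (MeasurableSet.univ_pi fun _ => measurableSet_Ioc) fun θ _ => ?_
    push_cast
    ring
  rw [hI, ← prod_rodRot_apply_eq_integral hn1 hn hc α a b c]
  -- left-hand side
  conv_lhs => rw [hα 0, hα 1, hα 2]
  simp only [PiLp.smul_apply, smul_eq_mul]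
  push_cast
  ring

end Synthesis

end Literature.Analysis.FluidPDE.Tao2016
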